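import Literature.Topology.FourManifolds.SweepLemma
import Mathlib.Geometry.Manifold.PartitionOfUnity
import Mathlib.Topology.MetricSpace.Thickening
import HarnessLib

/-!
# Absorbing the piece of a compact regular domain hanging below a level

Topic `Literature/Topology/FourManifolds`; geometric form of the sweep lemma
(`SweepLemma.lean`) in the exp-height line of the fact seat
`provefact-Literature.Topology.FourManifolds.SphereEmbedding.schoenflies_exists_ball`
(Alexander's theorem, Schultens (2014), Thm. 3.2.5).  **Everything in this file is proved; no
definitions, no named facts.**

In Alexander's argument (Schultens (2014), proof of Thm. 3.2.5, PDF pp. 44–45) a level disc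
`D` of the sphere `S` cuts off a disc `D₁ ⊂ S` carrying no saddle; `D ∪ D₁` bounds a ball
lying on one side of the level plane, and the sphere is isotoped across it.  On the level of
the region `A` bounded by `S` (case `D ⊂ A`), the piece `B` of `A` below the level enclosed by
`D ∪ D₁` is *swept away by the levels of the height*.  This file proves that move for compact
regular domains in a finite-dimensional inner product space, in the generality in which it is
true: `B` is any closed, relatively open piece of `A ∩ {h ≤ a}` (`h = ⟪v, ·⟫`) such that the
boundary is transverse to the level at the corner `∂A ∩ B ∩ {h = a}` and **no boundary point of
`B` strictly below the level has outward normal `+v`** (for a disc `D₁` below the level this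
says: no saddle and no local maximum of the height in its interior — Schultens' case `k = 0`).

* `SmoothMax.exists_thickening_inter_subset` — a compact clopen piece of a closed set is
  isolated: a metric neighbourhood meets the closed set only in the piece.
* `SmoothMax.exists_diffeomorph_image_sweep_below` — the move: for `N = thickening r B`
  isolating `B`, every admissible positive part `P` (`SmoothMax.exists_smoothPosPart`) and all
  small `δ > 0`, a diffeomorphism `Φ` of the ambient space supported in `K ∩ thickening (2r) B`
  carries `A` onto `(A ∖ N) ∪ (N ∩ {F ⊔_δ (a - h) ≤ 0})` — `A` with `B` removed and the new
  face on the level plane, the corner rounded by the smooth maximum — and `∂A` onto the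
  corresponding hypersurface.  (For a piece *above* a level apply it to `-v, -a`.)

Proof: the sweep lemma `SmoothMax.exists_diffeomorph_image_sweep` with the sweep function
`w = 1 + (h - a) + M ψ`, `ψ` a smooth cutoff (`exists_contMDiffMap_zero_one_of_isClosed`)
vanishing on `cthickening r B` and `= 1` off `thickening (2r) B`; the three hypotheses of the
sweep lemma come from the uniform regularity of `F` near `∂A`
(`ExpHeight.exists_norm_fderiv_ge`), the isolation of `B` (points of `A` in the shell
`cthickening (2r) B ∖ thickening r B` have `h ≥ a + r'`), and a compactness argument on the
closed cone condition `DF ∈ ℝ≥0 ⟪v, ·⟫` (`ExpHeight.exists_pos_forall_mem_of_cone`).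

## References

* J. Schultens, *Introduction to 3-Manifolds*, GSM 151 (2014), Lemma 3.2.3 and Thm. 3.2.5
  (PDF pp. 42–45). [Schultens2014]
* J. Milnor, *Morse theory*, Ann. of Math. Studies 51 (1963), Thm. 3.1. [Milnor1963]
-/

open scoped RealInnerProductSpace Topology Manifold ContDiff
open Set Filter Metric Function

noncomputable section

namespace Literature.Topology.FourManifolds

namespace SmoothMax

variable {E : Type*} [NormedAddCommGroup E] [InnerProductSpace ℝ E] [FiniteDimensional ℝ E]

/-! ### §1 Topological preliminaries on a clopen piece below a level -/

/-- **Isolation of a clopen piece.** If `B` is closed and relatively open in the closed set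
`A_a`, and `B` is compact, then a metric neighbourhood of `B` meets `A_a` only in `B`.
[folklore] -/
theorem exists_thickening_inter_subset {X : Type*} [MetricSpace X] {Aa B U : Set X}
    (hAa : IsClosed Aa) (hBc : IsCompact B)
    (hU : IsOpen U) (hB : Aa ∩ U = B) :
    ∃ r, 0 < r ∧ ∀ x ∈ Aa, x ∈ thickening (3 * r) B → x ∈ B := by
  -- `B ⊆ (Aa \ U)ᶜ`, an open set
  have hsub : B ⊆ (Aa \ U)ᶜ := by
    intro x hx hx'
    rw [← hB] at hx
    exact hx'.2 hx.2
  obtain ⟨ρ, hρ, hthick⟩ := hBc.exists_thickening_subset_open (hAa.sdiff hU).isOpen_compl hsub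
  refine ⟨ρ / 3, by positivity, fun x hxA hx => ?_⟩
  have hx' : x ∈ thickening ρ B := by rwa [show 3 * (ρ / 3) = ρ by ring] at hx
  have hxU : x ∈ U := by
    by_contra h
    exact hthick hx' ⟨hxA, h⟩
  rw [← hB]; exact ⟨hxA, hxU⟩

/-! ### §2 The geometric sweep: absorbing a piece below a level -/

/-- **Absorbing the piece of a compact regular domain hanging below a level.**  Let
`A = {F ≤ 0}` be a compact regular domain in a finite-dimensional inner product space
(`{F ≤ ε₀} ⊆ K` compact, `DF ≠ 0` on `∂A`), `v ≠ 0` a direction with height `h = ⟪v, ·⟫`,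
`a` a level, and `B ⊆ A ∩ {h ≤ a}` a closed and relatively open piece (so `B` meets the rest
of `A` only along the level `{h = a}`), such that
* at the corner points (`x ∈ B`, `F x = 0`, `h x = a`) the boundary `∂A` is transverse to the
  level (`DF(x)` is not a multiple of `⟪v, ·⟫`), and
* no boundary point of `B` strictly below the level has outward normal `+v`
  (`DF(x) ≠ c ⟪v, ·⟫` for `c > 0`): the situation of a disc of the sphere below a level disc
  carrying no saddle and no interior maximum of the height (Schultens (2014), proof of
  Thm. 3.2.5, case `k = 0`).
Then `B` can be swept away by the levels of the height: for a metric neighbourhood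
`N = thickening r B` of `B` meeting `A ∩ {h ≤ a}` only in `B`, every admissible positive part
`P`, and all small `δ > 0`, there is a diffeomorphism `Φ` of the ambient space, supported in
`K ∩ thickening (2r) B`, carrying `A` onto the region which is `A` off `N` and the rounded cut
`{F ⊔_δ (a - h) ≤ 0}` in `N` (and `∂A` onto the corresponding hypersurface).  Proof: the
sweep lemma `exists_diffeomorph_image_sweep` for `w = 1 + (h - a) + M ψ`, `ψ` a smooth cutoff
vanishing on `N` and `= 1` off `thickening (2r) B`. [folklore] -/
theorem exists_diffeomorph_image_sweep_below {P : ℝ → ℝ} (hP : ContDiff ℝ ∞ P)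
    (hP0 : ∀ s, s ≤ -1 → P s = 0) (hP1 : ∀ s, 1 ≤ s → P s = s)
    (hPd : ∀ s, 0 ≤ deriv P s ∧ deriv P s ≤ 1) (hPge : ∀ s, max 0 s ≤ P s)
    (hPle : ∀ s, P s ≤ max 0 s + 1)
    {F : E → ℝ} (hF : ContDiff ℝ ∞ F) {K : Set E} (hK : IsCompact K) {ε₀ : ℝ} (hε₀ : 0 < ε₀)
    (hKF : ∀ x, F x ≤ ε₀ → x ∈ K) (hreg : ∀ x, F x = 0 → fderiv ℝ F x ≠ 0)
    {v : E} (hv : v ≠ 0) {a : ℝ} {B U : Set E} (hBc : IsClosed B) (hU : IsOpen U)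
    (hB : {x | F x ≤ 0 ∧ ⟪v, x⟫ ≤ a} ∩ U = B)
    (hT : ∀ x ∈ B, F x = 0 → ⟪v, x⟫ = a → ∀ c : ℝ, fderiv ℝ F x ≠ c • innerSL ℝ v)
    (hS : ∀ x ∈ B, F x = 0 → ⟪v, x⟫ < a → ∀ c : ℝ, 0 < c → fderiv ℝ F x ≠ c • innerSL ℝ v) :
    ∃ r, 0 < r ∧ (∀ x, F x ≤ 0 → ⟪v, x⟫ ≤ a → x ∈ thickening (3 * r) B → x ∈ B) ∧
      ∃ δ₀, 0 < δ₀ ∧ ∀ δ, 0 < δ → δ < δ₀ →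
        ∃ Φ : E ≃ₘ⟮𝓘(ℝ, E), 𝓘(ℝ, E)⟯ E,
          Φ '' {x | F x ≤ 0} = ({x | F x ≤ 0} \ thickening r B) ∪
            (thickening r B ∩ {x | F x + δ * P ((a - ⟪v, x⟫ - F x) / δ) ≤ 0}) ∧
          Φ '' {x | F x = 0} = ({x | F x = 0} \ thickening r B) ∪
            (thickening r B ∩ {x | F x + δ * P ((a - ⟪v, x⟫ - F x) / δ) = 0}) ∧
          (∀ x, x ∉ K → Φ x = x) ∧ (∀ x, x ∉ thickening (2 * r) B → Φ x = x) := by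
  -- notation
  set A : Set E := {x | F x ≤ 0} with hA
  set Aa : Set E := {x | F x ≤ 0 ∧ ⟪v, x⟫ ≤ a} with hAa
  have hFc : Continuous F := hF.continuous
  have hhs : ContDiff ℝ ∞ fun x : E => ⟪v, x⟫ := (innerSL ℝ v).contDiff
  have hhc : Continuous fun x : E => ⟪v, x⟫ := hhs.continuous
  have hAc : IsCompact A :=
    hK.of_isClosed_subset (isClosed_le hFc continuous_const) fun x hx => hKF x (le_trans hx hε₀.le)
  have hAK : A ⊆ K := fun x hx => hKF x (le_trans hx hε₀.le)
  have hAac : IsClosed Aa := (isClosed_le hFc continuous_const).inter (isClosed_le hhc continuous_const)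
  have hBsub : B ⊆ Aa := by rw [← hB]; exact inter_subset_left
  have hBK : IsCompact B := hAc.of_isClosed_subset hBc fun x hx => (hBsub hx).1
  -- Step 1: isolation radius
  obtain ⟨r, hr, hiso⟩ := exists_thickening_inter_subset hAac hBK hU hB
  refine ⟨r, hr, fun x hF0 hh hx => hiso x ⟨hF0, hh⟩ hx, ?_⟩
  -- Step 2: the shell estimate `h ≥ a + r'` on `A ∩ (cthickening (2r) B \ thickening r B)`
  obtain ⟨r', hr', hshell⟩ : ∃ r', 0 < r' ∧ ∀ x ∈ A, x ∈ cthickening (2 * r) B →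
      x ∉ thickening r B → a + r' ≤ ⟪v, x⟫ := by
    set S : Set E := A ∩ (cthickening (2 * r) B \ thickening r B) with hS
    have hSc : IsCompact S := hAc.inter_right (isClosed_cthickening.sdiff isOpen_thickening)
    have hpos : ∀ x ∈ S, a < ⟪v, x⟫ := by
      intro x hx
      by_contra hle
      push Not at hle
      have hxB : x ∈ B := hiso x ⟨hx.1, hle⟩
        (cthickening_subset_thickening' (by positivity) (by linarith) B hx.2.1)
      exact hx.2.2 (self_subset_thickening hr B hxB)
    by_cases hne : S.Nonempty
    · obtain ⟨x₀, hx₀, hmin⟩ := hSc.exists_isMinOn hne hhc.continuousOn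
      refine ⟨⟪v, x₀⟫ - a, by linarith [hpos x₀ hx₀], fun x hxA hx1 hx2 => ?_⟩
      have := hmin (show x ∈ S from ⟨hxA, hx1, hx2⟩)
      simp only [mem_setOf_eq] at this
      linarith
    · exact ⟨1, one_pos, fun x hxA hx1 hx2 => (hne ⟨x, hxA, hx1, hx2⟩).elim⟩
  -- Step 3: the cone estimate: near `B`, in the collar, `DF ∈ ℝ≥0 ⟪v,·⟫` forces `h > a + η`
  set L : Set E := A ∩ cthickening r B with hL
  have hLc : IsCompact L := hAc.inter_right isClosed_cthickening
  obtain ⟨η, hη, hcone0⟩ : ∃ η, 0 < η ∧ ∀ x ∈ L, F x = 0 →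
      (∃ c : ℝ, 0 ≤ c ∧ fderiv ℝ F x = c • innerSL ℝ v) → a + 2 * η < ⟪v, x⟫ := by
    set L₀ : Set E := {x ∈ L | F x = 0 ∧ ∃ c : ℝ, 0 ≤ c ∧ fderiv ℝ F x = c • innerSL ℝ v} with hL₀
    have hcone_closed : IsClosed {x : E | ∃ c : ℝ, 0 ≤ c ∧ fderiv ℝ F x = c • innerSL ℝ v} := by
      have hDc : Continuous (fderiv ℝ F) := hF.continuous_fderiv (by simp)
      have h1 : Continuous fun x => fderiv ℝ F x v :=
        (ContinuousLinearMap.apply ℝ ℝ v).continuous.comp hDc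
      have : {x : E | ∃ c : ℝ, 0 ≤ c ∧ fderiv ℝ F x = c • innerSL ℝ v} =
          {x | fderiv ℝ F x = ((‖v‖ ^ 2)⁻¹ * fderiv ℝ F x v) • innerSL ℝ v ∧
            0 ≤ fderiv ℝ F x v} := by
        ext x; exact ExpHeight.exists_nonneg_eq_smul_iff hv _
      rw [this]
      exact (isClosed_eq hDc ((continuous_const.mul h1).smul continuous_const)).inter
        (isClosed_le continuous_const h1)
    have hL₀c : IsCompact L₀ := by
      refine hLc.of_isClosed_subset ?_ (fun x hx => hx.1)
      exact (hLc.isClosed.inter ((isClosed_singleton.preimage hFc).inter hcone_closed))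
    have hpos : ∀ x ∈ L₀, a < ⟪v, x⟫ := by
      rintro x ⟨hxL, hx0, hc⟩
      by_contra hle
      push Not at hle
      have hxB : x ∈ B := hiso x ⟨hxL.1, hle⟩
        (cthickening_subset_thickening' (by positivity) (by linarith) B hxL.2)
      obtain ⟨c, hc0, hc⟩ := hc
      rcases hle.lt_or_eq with hlt | heq
      · rcases hc0.lt_or_eq with hc0' | hc0'
        · exact hS x hxB hx0 hlt c hc0' hc
        · exact hreg x hx0 (by rw [hc, ← hc0', zero_smul])
      · exact hT x hxB hx0 heq c hc
    by_cases hne : L₀.Nonempty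
    · obtain ⟨x₀, hx₀, hmin⟩ := hL₀c.exists_isMinOn hne hhc.continuousOn
      refine ⟨(⟪v, x₀⟫ - a) / 3, by linarith [hpos x₀ hx₀], fun x hxL hx0 hc => ?_⟩
      have := hmin (show x ∈ L₀ from ⟨hxL, hx0, hc⟩)
      simp only [mem_setOf_eq] at this
      linarith [hpos x₀ hx₀]
    · exact ⟨1, one_pos, fun x hxL hx0 hc => (hne ⟨x, hxL, hx0, hc⟩).elim⟩
  obtain ⟨ε₁, hε₁, hcone⟩ := ExpHeight.exists_pos_forall_mem_of_cone (hF.of_le (by norm_cast))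
    hv hLc (isOpen_lt continuous_const hhc) (W := {x | a + 2 * η < ⟪v, x⟫})
    (fun x hxL hx0 hc => hcone0 x hxL hx0 hc)
  -- Step 4: uniform regularity on the collar
  obtain ⟨μ, hμ, ε₂, hε₂, hDF⟩ := ExpHeight.exists_norm_fderiv_ge (hF.of_le (by norm_cast)) hK
    (fun x _ hx => hreg x hx)
  -- Step 5: the cutoff and the sweep function
  obtain ⟨ψ, hψ0, hψ1, hψ01⟩ := exists_contMDiffMap_zero_one_of_isClosed 𝓘(ℝ, E)
    (isClosed_cthickening : IsClosed (cthickening r B))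
    (isOpen_thickening.isClosed_compl : IsClosed (thickening (2 * r) B)ᶜ)
    (by
      rw [Set.disjoint_compl_right_iff_subset]
      exact cthickening_subset_thickening' (by positivity) (by linarith) B) (n := (⊤ : ℕ∞))
  have hψs : ContDiff ℝ ∞ (ψ : E → ℝ) := ψ.contMDiff.contDiff
  -- bounds on `K`
  obtain ⟨C, hC⟩ : ∃ C, ∀ x ∈ K, |⟪v, x⟫| + |F x| ≤ C := by
    obtain ⟨C, hC⟩ := hK.exists_bound_of_continuousOn
      ((continuous_abs.comp hhc).add (continuous_abs.comp hFc)).continuousOn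
    exact ⟨C, fun x hx => le_trans (le_abs_self _) (by simpa [Real.norm_eq_abs] using hC x hx)⟩
  set M : ℝ := 2 + |a| + |C| with hM
  set w : E → ℝ := fun x => 1 + (⟪v, x⟫ - a) + M * ψ x with hw
  have hws : ContDiff ℝ ∞ w :=
    (contDiff_const.add (hhs.sub contDiff_const)).add (contDiff_const.mul hψs)
  -- `w` off `thickening r B` inside `A`: `w ≥ 1 + min r' 1`
  set m : ℝ := min r' 1 with hm
  have hm0 : 0 < m := lt_min hr' one_pos
  have hw_off : ∀ x ∈ A, x ∉ thickening r B → 1 + m ≤ w x := by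
    intro x hxA hx
    have hψx := hψ01 x
    have hmin1 := min_le_left r' 1
    have hmin2 := min_le_right r' 1
    have hM0 : 0 ≤ M := by positivity
    by_cases h2 : x ∈ cthickening (2 * r) B
    · have := hshell x hxA h2 hx
      have hMψ : 0 ≤ M * ψ x := mul_nonneg hM0 hψx.1
      simp only [hw]; linarith
    · have hψ1x : ψ x = 1 := hψ1 fun h => h2 (thickening_subset_cthickening _ _ h)
      have hCx := hC x (hAK hxA)
      have := neg_abs_le ⟪v, x⟫; have := le_abs_self a; have := le_abs_self C
      have := abs_nonneg (F x)
      simp only [hw, hψ1x, mul_one, hM]; linarith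
  -- far from `B` (inside `K`): `w + F ≥ 3`
  have hw_far : ∀ x ∈ K, x ∉ thickening (2 * r) B → 3 ≤ w x + F x := by
    intro x hxK hx
    have hψ1x : ψ x = 1 := hψ1 hx
    have hCx := hC x hxK
    have := neg_abs_le ⟪v, x⟫; have := le_abs_self a; have := le_abs_self C
    have := neg_abs_le (F x)
    simp only [hw, hψ1x, mul_one, hM]; linarith
  -- on `thickening r B`: `ψ = 0` near `x`, `w = 1 + (h - a)`, `Dw = ⟪v, ·⟫`
  have hψN : ∀ x ∈ thickening r B, ψ x = 0 := fun x hx =>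
    hψ0 (thickening_subset_cthickening _ _ hx)
  have hwN : ∀ x ∈ thickening r B, w x = 1 + (⟪v, x⟫ - a) := fun x hx => by
    simp only [hw, hψN x hx, mul_zero, add_zero]
  have hDwN : ∀ x ∈ thickening r B, fderiv ℝ w x = innerSL ℝ v := by
    intro x hx
    have hev : w =ᶠ[𝓝 x] fun y => 1 + (⟪v, y⟫ - a) :=
      (isOpen_thickening.eventually_mem hx).mono fun y hy => hwN y hy
    rw [hev.fderiv_eq]
    have h1 : HasFDerivAt (fun y : E => 1 + (⟪v, y⟫ - a)) (innerSL ℝ v) x := by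
      have := ((innerSL ℝ v).hasFDerivAt (x := x)).sub_const a |>.const_add 1
      simpa using this
    exact h1.fderiv
  have hℓ : (innerSL ℝ v : E →L[ℝ] ℝ) ≠ 0 := by
    intro h
    have : (innerSL ℝ v : E →L[ℝ] ℝ) v = 0 := by rw [h]; rfl
    rw [innerSL_apply_apply, real_inner_self_eq_norm_sq] at this
    exact hv (norm_eq_zero.1 (pow_eq_zero_iff two_ne_zero |>.1 this))
  -- Step 6: the smallness of `δ`
  refine ⟨min (m / 4) (min (ε₁ / 2) (min (ε₂ / 2) η)), by positivity, fun δ hδ hδ₀ => ?_⟩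
  have hδm : 4 * δ < m := by
    have := min_le_left (m / 4) (min (ε₁ / 2) (min (ε₂ / 2) η)); linarith
  have hδ1 : 2 * δ ≤ ε₁ := by
    have := (min_le_right (m / 4) _).trans (min_le_left (ε₁ / 2) (min (ε₂ / 2) η)); linarith
  have hδ2 : 2 * δ ≤ ε₂ := by
    have := (min_le_right (m / 4) _).trans ((min_le_right (ε₁ / 2) _).trans
      (min_le_left (ε₂ / 2) η)); linarith
  have hδη : δ ≤ η := by
    have := (min_le_right (m / 4) _).trans ((min_le_right (ε₁ / 2) _).trans
      (min_le_right (ε₂ / 2) η)); linarith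
  -- Step 7: the hypotheses of the sweep lemma
  have hKL : ∀ x, F x ≤ 0 → w x ≤ 1 + 2 * δ → x ∈ thickening r B := by
    intro x hx hwx
    by_contra hN
    have := hw_off x hx hN
    linarith
  have H1 : ∀ x, -(2 * δ) ≤ F x → F x ≤ 0 → fderiv ℝ F x ≠ 0 := by
    intro x h1 h2
    have := hDF x (hAK h2) (by rw [abs_le]; constructor <;> linarith)
    exact fun h => by rw [h, norm_zero] at this; linarith
  have H2 : ∀ x, F x ≤ 0 → w x ≤ 1 + 2 * δ → fderiv ℝ w x ≠ 0 := by
    intro x hx hwx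
    rw [hDwN x (hKL x hx hwx)]
    exact hℓ
  have H3 : ∀ x, -(2 * δ) ≤ F x → F x ≤ 0 → w x ≤ 1 + 2 * δ → ∀ c : ℝ, 0 < c →
      fderiv ℝ w x ≠ c • fderiv ℝ F x := by
    intro x h1 h2 hwx c hc hcw
    have hxN := hKL x h2 hwx
    rw [hDwN x hxN] at hcw
    have hcone' : ∃ c' : ℝ, 0 ≤ c' ∧ fderiv ℝ F x = c' • innerSL ℝ v :=
      ⟨c⁻¹, by positivity, by rw [hcw, smul_smul, inv_mul_cancel₀ hc.ne', one_smul]⟩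
    have hxL : x ∈ L := ⟨h2, thickening_subset_cthickening _ _ hxN⟩
    have := hcone x hxL (by linarith) h2 hcone'
    simp only [mem_setOf_eq] at this
    have hwx' := hwN x hxN
    linarith
  -- Step 8: the sweep lemma
  obtain ⟨Φ, himg, hzero, hfix, hKfix⟩ := exists_diffeomorph_image_sweep hP hP0 hP1 hPd hPge hPle
    hF hws hK hε₀ hKF hδ H1 H2 H3
  -- Step 9: identification of the swept region
  have hout : ∀ x, x ∉ thickening r B → F x ≤ 0 →
      F x + δ * P ((1 - w x - F x) / δ) ≤ 0 ∧
        (F x + δ * P ((1 - w x - F x) / δ) = 0 ↔ F x = 0) := by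
    intro x hxN hxA
    have hw1 : 1 - w x ≤ -m := by linarith [hw_off x hxA hxN]
    by_cases hcase : 1 - w x ≤ F x - δ
    · rw [smax_eq_left hP0 hδ hcase]
      exact ⟨hxA, Iff.rfl⟩
    · push Not at hcase
      have hlt : F x + δ * P ((1 - w x - F x) / δ) < 0 := by
        have := smax_le_max_add hPle hδ (F x) (1 - w x)
        have hmax : max (F x) (1 - w x) < -3 * δ := max_lt (by linarith) (by linarith)
        linarith
      exact ⟨hlt.le, ⟨fun h => absurd h hlt.ne, fun h => by linarith⟩⟩
  have hpos_out : ∀ x, 0 < F x → 0 < F x + δ * P ((1 - w x - F x) / δ) := fun x hx =>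
    lt_of_lt_of_le hx ((le_max_left _ _).trans (max_le_smax hPge hδ (F x) (1 - w x)))
  have hin : ∀ x ∈ thickening r B, 1 - w x - F x = a - ⟪v, x⟫ - F x := fun x hx => by
    rw [hwN x hx]; ring
  refine ⟨Φ, ?_, ?_, hKfix, fun x hx => ?_⟩
  · rw [himg]
    ext x
    simp only [mem_setOf_eq, mem_union, Set.mem_sdiff, mem_inter_iff]
    by_cases hxN : x ∈ thickening r B
    · rw [hin x hxN]
      exact ⟨fun h => Or.inr ⟨hxN, h⟩, fun h => h.elim (fun h' => (h'.2 hxN).elim) fun h' => h'.2⟩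
    · constructor
      · intro h
        refine Or.inl ⟨?_, hxN⟩
        rcases le_or_gt (F x) 0 with hle | hgt
        · exact hle
        · linarith [hpos_out x hgt]
      · intro h
        rcases h with h | h
        · exact (hout x hxN h.1).1
        · exact (hxN h.1).elim
  · rw [hzero]
    ext x
    simp only [mem_setOf_eq, mem_union, Set.mem_sdiff, mem_inter_iff]
    by_cases hxN : x ∈ thickening r B
    · rw [hin x hxN]
      exact ⟨fun h => Or.inr ⟨hxN, h⟩, fun h => h.elim (fun h' => (h'.2 hxN).elim) fun h' => h'.2⟩
    · constructor
      · intro h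
        refine Or.inl ⟨?_, hxN⟩
        have hF0 : F x ≤ 0 := by
          rcases le_or_gt (F x) 0 with hle | hgt
          · exact hle
          · linarith [hpos_out x hgt]
        exact (hout x hxN hF0).2.1 h
      · intro h
        rcases h with h | h
        · exact ((hout x hxN h.1.le).2).2 h.1
        · exact (hxN h.1).elim
  · by_cases hxK : x ∈ K
    · have : δ < 1 := by linarith [hδm, min_le_right r' 1]
      exact hfix x (by linarith [hw_far x hxK hx])
    · exact hKfix x hxK

end SmoothMax

end Literature.Topology.FourManifolds

end
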